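import Literature.NumberTheory.LFunctions.NoRealZeroEvenSmallModuliVI
import Literature.NumberTheory.LFunctions.NoRealZeroOddSmallModuliIII
import HarnessLib

/-!
# The kernel base of the no-real-zero column, both parities: `NoRealZeroUpTo 266`, unconditionally

Topic `Literature/NumberTheory/LFunctions`; namespace `Literature.NumberTheory.LFunctions`. THEOREMS only.
Joins the even kernel base `436` (`noRealZeroEvenUpTo_436`, `NoRealZeroEvenSmallModuliVI.lean`) and the
odd kernel base `266` (`noRealZeroOddUpTo_266`, `NoRealZeroOddSmallModuliIII.lean`, which passes the
former wall `d = 232` by Low's grouping of Epstein zeta functions):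
**`noRealZeroUpTo_266 : NoRealZeroUpTo 266`** — for every modulus `3 ≤ q ≤ 266`, every primitive
quadratic Dirichlet character `χ` mod `q` and every `σ ∈ (0, 1)`, `L(σ, χ) ≠ 0` — with no named fact
(previous both-parity base: `231`, `noRealZeroUpTo_231`). The next odd wall is `d = 403`
(`h(−403) = 2`, partner class `(11, 9, 11)` of height `√403/22 < 1`); the even wall is `437`.

## References

* M. E. Low, *Real zeros of the Dedekind zeta function of an imaginary quadratic field*, Acta Arith. 14
  (1968) 117–140. [Low1968]
* H. L. Montgomery, R. C. Vaughan, *Multiplicative Number Theory I*, CUP 2007, §11.2.1 Exercises 7–8.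
  [MontgomeryVaughan2007]
-/

namespace Literature.NumberTheory.LFunctions

/-- **`NoRealZeroUpTo 266`, both parities, unconditionally** (odd base `266`, even base `436`).
[cite: Low1968, Theorem 5 (via MR 38#4425)] [cite: MontgomeryVaughan2007, §11.2.1 Exercises 7 (g), 8] -/
theorem noRealZeroUpTo_266 : NoRealZeroUpTo 266 :=
  NoRealZeroUpTo.iff_odd_and_even.mpr
    ⟨noRealZeroOddUpTo_266,
      fun q _ hq3 hq χ hquad hprim heven σ hσ0 hσ1 ↦
        noRealZeroEvenUpTo_436 q hq3 (by omega) χ hquad hprim heven σ hσ0 hσ1⟩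

/-- `NoExceptionalZeroUpTo 266 c` for every `c`. [cite: Low1968, Theorem 5 (via MR 38#4425)] -/
theorem noExceptionalZeroUpTo_266 (c : ℝ) : NoExceptionalZeroUpTo 266 c :=
  noRealZeroUpTo_266.noExceptionalZeroUpTo c

/-- The kernel bases of the wide column after this file: both parities to `266`, even to `436`,
odd to `266`. [cite: Low1968, Theorem 5 (via MR 38#4425)] -/
theorem noRealZero_kernelBase_266_436 : NoRealZeroUpTo 266 ∧ NoRealZeroEvenUpTo 436 :=
  ⟨noRealZeroUpTo_266, noRealZeroEvenUpTo_436⟩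

end Literature.NumberTheory.LFunctions
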